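import Literature.MathematicalPhysics.QuantumFieldTheory.Balaban1983to89.B9Thm31SiteGpGradDecayReg335Y

/-!
# `Balaban1983to89.B9Thm31SiteGradGpDivDecayReg335Y` — T. Bałaban, *Propagators for lattice gauge theories in a background field*, Commun. Math. Phys. **99**
# (1985) 389–434 [Balaban1985BackgroundPropagators] Thm 3.1 (3.46)∕(3.47) p. 398 (the entry `∇_U G′(U) ∇\*_U`) with (3.8) p. 392, by S. Agmon's method [Agmon1982]:
# ★★★ **THE ORDER-ZERO OPERATOR `∇_U G′(U) ∇\*_U` AT def-Y's LETTERS — `‖∇_{U,ν}G′(U)∇\*_{U,μ}λ‖₁ ≤ ‖λ‖₁` GLOBALLY AT EVERY UNITARY BACKGROUND (no smallness), and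
# on the (3.35) class the `L²`-local decay `Σ_{z∈A}Σ_ν HS((∇_{U,ν}G′(U)∇\*_{U,μ}λ)(z)) ≤ 10·W⁻²·‖λ‖²₁`** — print's `‖hζ∇_UG′(U)∇\*_Uζ′λ‖ ≤ B₀·1·e^{−δ₀d}‖h‖‖λ‖`
# shape with NO scale factor (file 14 of the site-coercivity set of width seat `pub-ymgap-dag-n06-w1`)

statement-level skeleton of published theorems with citation tags; proofs where landed; nothing here is a claim about the Yang–Mills mass gap

THE PRINT (p. 398, verbatim).  (3.46): *«‖hG′(U)λ‖, ‖hζ∇_UG′(U)λ‖(Lʲη), ‖hG′(U)∇\*_Uζλ‖(Lʲη), … ≤ B₀(Lʲη)(Lʲ′η)e^{−δ₀d(y,y′)}‖h‖‖λ‖»* with the prefactor list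
`[(Lʲη)², Lʲη, Lʲη, 1, 1, 1]` for `[G′, ∇G′, G′∇\*, Δ_UG′, ∇G′∇\*, …]`; (3.47): *«|∇_UG′(U)∇\*_Uλ|_{(γ)} ≤ B₀|λ|_{(γ)}»* — `∇_UG′∇\*_U` is an operator of ORDER ZERO.

WHY THIS FILE ∕ THE ARGUMENT.  (a) GLOBAL: with `v = ∇\*_{U,μ}λ` and `Φ = G′(U)v`, file 8's `Σ_ν‖∇_{U,ν}Φ‖²₁ ≤ ⟨Φ, Δ′_a(U)Φ⟩₁ = ⟨Φ, v⟩₁ = ⟨∇_{U,μ}Φ, λ⟩₁ ≤ ‖∇_{U,μ}Φ‖₁‖λ‖₁`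
(dag-n06-i's `trIP_cdS_left`), so `E ≤ √E·‖λ‖`, i.e. `Σ_ν‖∇_{U,ν}G′(U)∇\*_{U,μ}λ‖²₁ ≤ ‖λ‖²₁` at EVERY `G`-valued `U` — the Riesz-transform bound from positivity
alone.  (b) LOCAL: the Agmon bookkeeping of file 8 with the source `v` (supported where `ω = 1`): `X := ⟨Φ, v⟩₁ ≤ ‖λ‖²₁` replaces file 6's second reading, and
`W²·Σ_{z∈A}Σ_νHS(∇_νΦ(z)) ≤ 2(X + κM) + 6(d+1)θ_bM ≤ 10X ≤ 10‖λ‖²₁`.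

WHAT IS PROVED (sorry-free; 0 `def`; nothing of [B9] asserted beyond what is proved).
* §1 ★★★ **`sum_trIP_cdS_GpY_cdsS_le`** (`Σ_ν ‖∇_{U,ν}G′(U)∇\*_{U,μ}λ‖²₁ ≤ ‖λ‖²₁`, every `G`-valued `U`, `G ≤ U(N)`), ★★ `trIP_cdS_GpY_cdsS_le` (one direction).
* §2 `sum_wsq_hs_cdS_le` (the per-bond algebra of file 8, summed, for ANY field `Φ`: `Σ_zΣ_ν ω_z²HS(∇_νΦ z) ≤ 2Σ_ν‖∇_ν(ωΦ)‖²₁ + 6(d+1)θ_b·Σ_z m_zHS(ω_zΦ z)`),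
  `graddiv_arith`, ★★★ **`hs_restrict_cdS_GpY_cdsS_le`** (abstract weight: class, `ω = 1` on `B ⊇ supp ∇\*_{U,μ}λ`, `ω ≥ W > 0` on `A`, bond ratios, block oscillation,
  `(d+1)θ_b + θ_s∕2 ≤ 1∕16`, `0 ≤ θ_b, θ_s`: `Σ_{z∈A}Σ_ν HS((∇_{U,ν}G′(U)∇\*_{U,μ}λ)(z)) ≤ 10·W⁻²·‖λ‖²₁`), ★★★ **`hs_restrict_cdS_GpY_cdsS_le_exp_canonical`**
  (`e^{δ₀ρ}`, `δ₀ = 1∕(4(d+2))`: `… ≤ 10·(e^{δ₀r})⁻²·‖λ‖²₁`).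
MODEL ∕ DECLARED READINGS.  As files 6–8; `∇_{U,ν} = cdS i U ν`, `∇\*_{U,μ} = cdsS i U μ`; the support hypothesis is on `∇\*_{U,μ}λ` (one lattice step wider than
`supp λ`).  NOT HERE: (3.42)–(3.45), the sup-norm (3.47), the bond sector.  HONEST SCOPE.  `L²` estimates for one finite lattice operator at a time; NOT a node
discharge, NOT summit progress; count-neutral; nothing continuum ∕ OS ∕ mass gap ∕ Clay.  NEW file importing file 8 only.  Net new unproved facts: 0.
-/

noncomputable section

namespace Literature.MathematicalPhysics.QuantumFieldTheory.Balaban1983to89.B9Thm31SiteGradGpDivDecayReg335Y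

open Literature.MathematicalPhysics.QuantumFieldTheory.Balaban1983to89
open Node00 B6KLevelCensusIndexV1 B6Geom246MultiLevelBox B6MultiLevelBoxOperator B6MultiLevelTorusOperator B6GlobalChartV1 B9BackgroundsKLevelV1
  B9Eq39Adjoint B9Thm311ReadingCoords B9Thm311DeltaPrimePos B9Ineq369CurvatureSmallAtLettersY B9Thm31SiteCoerciveGaugeBlockY
  B9Thm31SiteCoerciveReg335Y B9Thm31SiteGpBoundsReg335Y B9Thm31SitePolarisedFormY B9Thm31SiteConjugatedFormY B9Thm31SiteGpDecayReg335Y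
  B9Thm31SiteAgmonWeightY B9Thm31SiteGpGradDecayReg335Y
open Literature.MathematicalPhysics.QuantumFieldTheory.Balaban1983to89.B9Ineq349SiteAdjoint (trIP_comm trIP_cdS_left)
open Literature.MathematicalPhysics.QuantumFieldTheory.Balaban1983to89.B9Thm311FlippedBondLetters (hs_real_smul)
open scoped Matrix Matrix.Norms.L2Operator

variable {d ℓ : ℕ} {hd : 1 ≤ d + 1} {hL : Odd (ℓ + 1) ∧ 1 < ℓ + 1} {b₀ b₁ : ℝ}
variable (i : KIdx d ℓ hd hL b₀ b₁) {N : ℕ} {G : Subgroup (Matrix (Fin N) (Fin N) ℂ)ˣ}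

/-! ## §1 The global bound: `∇_U G′(U) ∇*_U` is a contraction in every direction, at every unitary background -/

/-- ★★★ **`Σ_ν ‖∇_{U,ν}G′(U)∇\*_{U,μ}λ‖²₁ ≤ ‖λ‖²₁` AT EVERY `G`-VALUED BACKGROUND**, `G ≤ U(N)` (no smallness): the energy of `Φ = G′∇\*λ` is `⟨Φ, Δ′_aΦ⟩ = ⟨∇Φ, λ⟩`,
Cauchy–Schwarz closes. [cite: Balaban1985BackgroundPropagators, Thm 3.1 (3.47) p.398 (|∇_UG′∇\*_Uλ| ≤ B₀|λ|), (3.8) p.392, (3.24) p.394] -/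
theorem sum_trIP_cdS_GpY_cdsS_le (hG : G ≤ B7Prop2Explicit.unitaryUnits (Matrix (Fin N) (Fin N) ℂ)) {U : CfgY (Matrix (Fin N) (Fin N) ℂ) i}
    (hU : ∀ μ x, U μ x ∈ G) (μ : Fin (d + 1)) (Λ : SiteY i → Matrix (Fin N) (Fin N) ℂ) :
    ∑ ν : Fin (d + 1), trIP (fun _ => (1 : ℝ)) (cdS i U ν (GpY i (parSymY i) U (cdsS i U μ Λ))) (cdS i U ν (GpY i (parSymY i) U (cdsS i U μ Λ)))
      ≤ trIP (fun _ => (1 : ℝ)) Λ Λ := by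
  set Φ := GpY i (parSymY i) U (cdsS i U μ Λ) with hΦ
  set E := ∑ ν : Fin (d + 1), trIP (fun _ => (1 : ℝ)) (cdS i U ν Φ) (cdS i U ν Φ) with hE
  have hunit : IsUnit (deltaPrimeAY i (parSymY i) U) := isUnit_deltaPrimeAY_parSymY i hG hU
  have hΔΦ : deltaPrimeAY i (parSymY i) U Φ = cdsS i U μ Λ := apply_inverse_of_isUnit hunit _
  have hE0 : 0 ≤ E := Finset.sum_nonneg fun _ _ => trIP_self_nonneg _ (fun _ => one_pos) _
  have hQ0 : 0 ≤ trIP (fun _ => (1 : ℝ)) Λ Λ := trIP_self_nonneg _ (fun _ => one_pos) Λ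
  -- `E ≤ ⟨Φ, Δ′Φ⟩ = ⟨Φ, ∇*λ⟩ = ⟨∇_μΦ, λ⟩`
  have h1 : E ≤ trIP (fun _ => (1 : ℝ)) (cdS i U μ Φ) Λ := by
    have h := sum_trIP_cdS_le_trIP_deltaPrimeAY i hG (parSymY i) U (parSymY_inv_symm U) (fun z w => parSymY_mem i hU z w) hU Φ
    rw [hΔΦ, ← trIP_cdS_left i (fun μ x => hG (hU μ x)) μ Φ Λ] at h
    exact h
  -- Cauchy–Schwarz and `‖∇_μΦ‖² ≤ E`
  have h2 : trIP (fun _ => (1 : ℝ)) (cdS i U μ Φ) Λ ^ 2 ≤ E * trIP (fun _ => (1 : ℝ)) Λ Λ := by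
    have hcs := trIP_sq_le (fun _ => (1 : ℝ)) (fun _ => one_pos) (cdS i U μ Φ) Λ
    have hμ : trIP (fun _ => (1 : ℝ)) (cdS i U μ Φ) (cdS i U μ Φ) ≤ E :=
      Finset.single_le_sum (f := fun ν => trIP (fun _ => (1 : ℝ)) (cdS i U ν Φ) (cdS i U ν Φ)) (fun _ _ => trIP_self_nonneg _ (fun _ => one_pos) _)
        (Finset.mem_univ μ)
    exact hcs.trans (mul_le_mul_of_nonneg_right hμ hQ0)
  have h3 : E ^ 2 ≤ E * trIP (fun _ => (1 : ℝ)) Λ Λ := (pow_le_pow_left₀ hE0 h1 2).trans h2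
  rcases hE0.eq_or_lt with h0 | hpos
  · rw [← h0]; exact hQ0
  · have h4 : E * E ≤ trIP (fun _ => (1 : ℝ)) Λ Λ * E := by nlinarith
    exact le_of_mul_le_mul_right h4 hpos

/-- ★★ one direction: `‖∇_{U,ν}G′(U)∇\*_{U,μ}λ‖²₁ ≤ ‖λ‖²₁` at every `G`-valued background. [cite: Balaban1985BackgroundPropagators, Thm 3.1 (3.47) p.398] -/
theorem trIP_cdS_GpY_cdsS_le (hG : G ≤ B7Prop2Explicit.unitaryUnits (Matrix (Fin N) (Fin N) ℂ)) {U : CfgY (Matrix (Fin N) (Fin N) ℂ) i}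
    (hU : ∀ μ x, U μ x ∈ G) (ν μ : Fin (d + 1)) (Λ : SiteY i → Matrix (Fin N) (Fin N) ℂ) :
    trIP (fun _ => (1 : ℝ)) (cdS i U ν (GpY i (parSymY i) U (cdsS i U μ Λ))) (cdS i U ν (GpY i (parSymY i) U (cdsS i U μ Λ))) ≤ trIP (fun _ => (1 : ℝ)) Λ Λ :=
  le_trans (Finset.single_le_sum (f := fun ν => trIP (fun _ => (1 : ℝ)) (cdS i U ν (GpY i (parSymY i) U (cdsS i U μ Λ))) (cdS i U ν (GpY i (parSymY i) U (cdsS i U μ Λ))))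
    (fun _ _ => trIP_self_nonneg _ (fun _ => one_pos) _) (Finset.mem_univ ν)) (sum_trIP_cdS_GpY_cdsS_le i hG hU μ Λ)

/-! ## §2 The local decay on the class -/

/-- THE WEIGHTED GRADIENT ENERGY DOMINATES THE `ω²`-WEIGHTED ENERGY (any field `Φ`, `G`-valued `U`, `G ≤ U(N)`; bond ratios `q(ω(z+e_μ), ω z) ≤ θ_b·m_{z+e_μ}`,
`0 ≤ θ_b ≤ 1∕16`): `Σ_zΣ_ν ω_z²HS((∇_{U,ν}Φ)(z)) ≤ 2Σ_ν‖∇_{U,ν}(ωΦ)‖²₁ + 6(d+1)θ_b·Σ_z m_zHS(ω_zΦ(z))`. [cite: Agmon1982, Ch.1; Balaban1985BackgroundPropagators, (3.3) p.390] -/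
theorem sum_wsq_hs_cdS_le (hG : G ≤ B7Prop2Explicit.unitaryUnits (Matrix (Fin N) (Fin N) ℂ)) {U : CfgY (Matrix (Fin N) (Fin N) ℂ) i}
    (hU : ∀ μ x, U μ x ∈ G) {ω : SiteY i → ℝ} (hω : ∀ z, 0 < ω z) {θb : ℝ} (hθb0 : 0 ≤ θb) (hθb1 : θb ≤ 1 / 16)
    (hb2 : ∀ μ z, ω (shiftY i μ z) / ω z + ω z / ω (shiftY i μ z) - 2 ≤ θb * (((((ℓ + 1) ^ (blkOf i.D.toDomains (shiftY i μ z)).1.1 : ℕ) : ℝ)) ^ 2)⁻¹)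
    (Φ : SiteY i → Matrix (Fin N) (Fin N) ℂ) :
    ∑ z : SiteY i, ∑ ν : Fin (d + 1), ω z ^ 2 * ∑ a, ∑ b, ‖cdS i U ν Φ z a b‖ ^ 2
      ≤ 2 * ∑ ν : Fin (d + 1), trIP (fun _ => (1 : ℝ)) (cdS i U ν (fun w => ((ω w : ℝ) : ℂ) • Φ w)) (cdS i U ν (fun w => ((ω w : ℝ) : ℂ) • Φ w))
        + 6 * (((d : ℝ) + 1) * θb) *
          ∑ z : SiteY i, (((((ℓ + 1) ^ (blkOf i.D.toDomains z).1.1 : ℕ) : ℝ)) ^ 2)⁻¹ * ∑ a, ∑ b, ‖(((ω z : ℝ) : ℂ) • Φ z) a b‖ ^ 2 := by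
  have hm1 : ∀ z : SiteY i, (((((ℓ + 1) ^ (blkOf i.D.toDomains z).1.1 : ℕ) : ℝ)) ^ 2)⁻¹ ≤ 1 := fun z => by
    have h1 : (1 : ℝ) ≤ (((ℓ + 1) ^ (blkOf i.D.toDomains z).1.1 : ℕ) : ℝ) := by exact_mod_cast Nat.one_le_pow _ _ (Nat.succ_pos ℓ)
    exact inv_le_one_of_one_le₀ (by nlinarith)
  have hdef : ∀ μ z, (ω (shiftY i μ z) - ω z) ^ 2 * ∑ a, ∑ b, ‖Φ (shiftY i μ z) a b‖ ^ 2
      ≤ 3 * θb * ((((((ℓ + 1) ^ (blkOf i.D.toDomains (shiftY i μ z)).1.1 : ℕ) : ℝ)) ^ 2)⁻¹ *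
          ∑ a, ∑ b, ‖(((ω (shiftY i μ z) : ℝ) : ℂ) • Φ (shiftY i μ z)) a b‖ ^ 2) := by
    intro μ z
    have hθm : θb * (((((ℓ + 1) ^ (blkOf i.D.toDomains (shiftY i μ z)).1.1 : ℕ) : ℝ)) ^ 2)⁻¹ ≤ 1 := by
      have h0 : (0 : ℝ) ≤ (((((ℓ + 1) ^ (blkOf i.D.toDomains (shiftY i μ z)).1.1 : ℕ) : ℝ)) ^ 2)⁻¹ := inv_nonneg.2 (by positivity)
      nlinarith [hm1 (shiftY i μ z)]
    have h := sq_sub_le_of_q_le (hω (shiftY i μ z)) (hω z) (hb2 μ z) hθm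
    rw [hs_real_smul]
    have hX' := hs_nonneg (Φ (shiftY i μ z))
    calc (ω (shiftY i μ z) - ω z) ^ 2 * ∑ a, ∑ b, ‖Φ (shiftY i μ z) a b‖ ^ 2
        ≤ (3 * (θb * (((((ℓ + 1) ^ (blkOf i.D.toDomains (shiftY i μ z)).1.1 : ℕ) : ℝ)) ^ 2)⁻¹) * ω (shiftY i μ z) ^ 2) *
            ∑ a, ∑ b, ‖Φ (shiftY i μ z) a b‖ ^ 2 := mul_le_mul_of_nonneg_right h hX'
      _ = _ := by ring
  rw [Finset.sum_comm]
  have hμ : ∀ μ : Fin (d + 1), ∑ z : SiteY i, ω z ^ 2 * ∑ a, ∑ b, ‖cdS i U μ Φ z a b‖ ^ 2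
      ≤ 2 * trIP (fun _ => (1 : ℝ)) (cdS i U μ (fun w => ((ω w : ℝ) : ℂ) • Φ w)) (cdS i U μ (fun w => ((ω w : ℝ) : ℂ) • Φ w))
        + 6 * θb * ∑ z : SiteY i, (((((ℓ + 1) ^ (blkOf i.D.toDomains z).1.1 : ℕ) : ℝ)) ^ 2)⁻¹ * ∑ a, ∑ b, ‖(((ω z : ℝ) : ℂ) • Φ z) a b‖ ^ 2 := by
    intro μ
    have hz : ∀ z, ω z ^ 2 * ∑ a, ∑ b, ‖cdS i U μ Φ z a b‖ ^ 2
        ≤ 2 * ∑ a, ∑ b, ‖cdS i U μ (fun w => ((ω w : ℝ) : ℂ) • Φ w) z a b‖ ^ 2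
          + 2 * (3 * θb * ((((((ℓ + 1) ^ (blkOf i.D.toDomains (shiftY i μ z)).1.1 : ℕ) : ℝ)) ^ 2)⁻¹ *
              ∑ a, ∑ b, ‖(((ω (shiftY i μ z) : ℝ) : ℂ) • Φ (shiftY i μ z)) a b‖ ^ 2)) := by
      intro z
      have h1 := hs_wsmul_cdS_le i hG hU μ ω Φ z
      have h2 := hdef μ z
      linarith
    refine (Finset.sum_le_sum fun z _ => hz z).trans (le_of_eq ?_)
    rw [Finset.sum_add_distrib, ← Finset.mul_sum, ← Finset.mul_sum, trIP_one_self_eq,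
      Equiv.sum_comp (shiftY i μ) (fun z => 3 * θb * ((((((ℓ + 1) ^ (blkOf i.D.toDomains z).1.1 : ℕ) : ℝ)) ^ 2)⁻¹ *
        ∑ a, ∑ b, ‖(((ω z : ℝ) : ℂ) • Φ z) a b‖ ^ 2)), ← Finset.mul_sum]
    ring
  calc ∑ μ : Fin (d + 1), ∑ z : SiteY i, ω z ^ 2 * ∑ a, ∑ b, ‖cdS i U μ Φ z a b‖ ^ 2
      ≤ ∑ μ : Fin (d + 1), (2 * trIP (fun _ => (1 : ℝ)) (cdS i U μ (fun w => ((ω w : ℝ) : ℂ) • Φ w)) (cdS i U μ (fun w => ((ω w : ℝ) : ℂ) • Φ w))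
          + 6 * θb * ∑ z : SiteY i, (((((ℓ + 1) ^ (blkOf i.D.toDomains z).1.1 : ℕ) : ℝ)) ^ 2)⁻¹ * ∑ a, ∑ b, ‖(((ω z : ℝ) : ℂ) • Φ z) a b‖ ^ 2) :=
        Finset.sum_le_sum fun μ _ => hμ μ
    _ = _ := by
        rw [Finset.sum_add_distrib, ← Finset.mul_sum, Finset.sum_const, Finset.card_univ, Fintype.card_fin, nsmul_eq_mul]; push_cast; ring

/-- THE ARITHMETIC OF §2: `E ≤ X + κM`, `S ≤ 2E + 6θM`, `W²P ≤ S`, `κ, θ ≤ 1∕16`, `(1∕8 − κ)M ≤ X`, `X ≤ Q`, `M ≥ 0`, `W > 0` ⇒ `P ≤ 10·Q∕W²`.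
[cite: Agmon1982, Ch.1, bookkeeping] -/
theorem graddiv_arith {E X M S P Q W κ θ : ℝ} (hE : E ≤ X + κ * M) (hS : S ≤ 2 * E + 6 * θ * M) (hP : W ^ 2 * P ≤ S) (hκ : κ ≤ 1 / 16)
    (hθ : θ ≤ 1 / 16) (hiX : (1 / 8 - κ) * M ≤ X) (hXQ : X ≤ Q) (hM0 : 0 ≤ M) (hW : 0 < W) : P ≤ 10 * Q / W ^ 2 := by
  have hc : (1 / 16 : ℝ) ≤ 1 / 8 - κ := by linarith
  have hMX : M ≤ 16 * X := by nlinarith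
  have h2 : W ^ 2 * P ≤ 10 * Q := by nlinarith
  have hW2 : 0 < W ^ 2 := by positivity
  rw [le_div_iff₀ hW2]
  linarith

/-- ★★★ **THE `L²`-LOCAL DECAY OF `∇_U G′(U) ∇\*_U` ON THE CLASS (3.35)** — (3.46e)'s SHAPE, NO SCALE FACTOR.  `G ≤ U(N)`, `N ≥ 1`, `0 ≤ c·M·α₀`,
`c·M·α₀·(d+1) ≤ 1∕16`, `U ∈ Reg335 c α₀`; a weight `ω > 0` with `ω = 1` on `B ⊇ supp ∇\*_{U,μ}λ`, `ω ≥ W > 0` on `A`, bond ratios `q ≤ θ_b·(L^{lev})⁻²` (both ends),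
block oscillation `q ≤ θ_s`, `0 ≤ θ_b, θ_s`, `(d+1)θ_b + θ_s∕2 ≤ 1∕16`.  THEN `Σ_{z∈A}Σ_ν HS((∇_{U,ν}G′(U)∇\*_{U,μ}λ)(z)) ≤ 10·‖λ‖²₁∕W²`.
[cite: Balaban1985BackgroundPropagators, Thm 3.1 (3.46) p.398, (3.35) p.396; Agmon1982, Ch.1, Thm 1.5] -/
theorem hs_restrict_cdS_GpY_cdsS_le [Nonempty (Fin N)] (hG : G ≤ B7Prop2Explicit.unitaryUnits (Matrix (Fin N) (Fin N) ℂ))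
    {U : CfgY (Matrix (Fin N) (Fin N) ℂ) i} {c α₀ : ℝ} (hC0 : 0 ≤ c * (kGeo i).M * α₀) (hC1 : c * (kGeo i).M * α₀ * ((d : ℝ) + 1) ≤ 1 / 16)
    (hreg : (bg9K (Matrix (Fin N) (Fin N) ℂ) G i).Reg335 c α₀ U) {ω : SiteY i → ℝ} (hω : ∀ z, 0 < ω z) {θb θs : ℝ} (hθb0 : 0 ≤ θb) (hθs0 : 0 ≤ θs)
    (hb1 : ∀ μ z, ω (shiftY i μ z) / ω z + ω z / ω (shiftY i μ z) - 2 ≤ θb * (((((ℓ + 1) ^ (blkOf i.D.toDomains z).1.1 : ℕ) : ℝ)) ^ 2)⁻¹)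
    (hb2 : ∀ μ z, ω (shiftY i μ z) / ω z + ω z / ω (shiftY i μ z) - 2 ≤ θb * (((((ℓ + 1) ^ (blkOf i.D.toDomains (shiftY i μ z)).1.1 : ℕ) : ℝ)) ^ 2)⁻¹)
    (hs : ∀ z w : SiteY i, blkOf i.D.toDomains w = blkOf i.D.toDomains z → ω z / ω w + ω w / ω z - 2 ≤ θs)
    (hκ : ((d : ℝ) + 1) * θb + θs / 2 ≤ 1 / 16) (μ : Fin (d + 1))
    {A B : Finset (SiteY i)} {Λ : SiteY i → Matrix (Fin N) (Fin N) ℂ} (hv : ∀ z, z ∉ B → cdsS i U μ Λ z = 0) (hωB : ∀ z ∈ B, ω z = 1)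
    {W : ℝ} (hW0 : 0 < W) (hW : ∀ z ∈ A, W ≤ ω z) :
    ∑ z ∈ A, ∑ ν : Fin (d + 1), ∑ a, ∑ b, ‖cdS i U ν (GpY i (parSymY i) U (cdsS i U μ Λ)) z a b‖ ^ 2
      ≤ 10 * trIP (fun _ => (1 : ℝ)) Λ Λ / W ^ 2 := by
  have hU : ∀ μ x, U μ x ∈ G := hreg.1
  have hθ : ((d : ℝ) + 1) * θb ≤ 1 / 16 := by linarith
  have hθb1 : θb ≤ 1 / 16 := by
    have : (0 : ℝ) ≤ d := Nat.cast_nonneg d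
    nlinarith
  set v := cdsS i U μ Λ with hvdef
  have hM0 : 0 ≤ ∑ z : SiteY i, (((((ℓ + 1) ^ (blkOf i.D.toDomains z).1.1 : ℕ) : ℝ)) ^ 2)⁻¹ * ∑ a, ∑ b, ‖(((ω z : ℝ) : ℂ) • GpY i (parSymY i) U v z) a b‖ ^ 2 :=
    Finset.sum_nonneg fun z _ => mul_nonneg (inv_nonneg.2 (by positivity)) (hs_nonneg _)
  -- Agmon's first reading with the source `v`: `c₀ M ≤ X = ⟨Φ, v⟩`
  have hiX := levelMass_wsmul_GpY_le_pairing i hG hC0 hC1 hreg hω hb1 hb2 hs hv hωB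
  -- `X ≤ ‖λ‖²`: `X = ⟨∇_μΦ, λ⟩ ≤ ‖∇_μΦ‖‖λ‖` and `‖∇_μΦ‖² ≤ Σ_ν‖∇_νΦ‖² ≤ X`
  have hQ0 : 0 ≤ trIP (fun _ => (1 : ℝ)) Λ Λ := trIP_self_nonneg _ (fun _ => one_pos) Λ
  have hunit : IsUnit (deltaPrimeAY i (parSymY i) U) := isUnit_deltaPrimeAY_parSymY i hG hU
  have hΔΦ : deltaPrimeAY i (parSymY i) U (GpY i (parSymY i) U v) = v := apply_inverse_of_isUnit hunit _
  have hXeq : trIP (fun _ => (1 : ℝ)) (GpY i (parSymY i) U v) v = trIP (fun _ => (1 : ℝ)) (cdS i U μ (GpY i (parSymY i) U v)) Λ := by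
    rw [hvdef, trIP_cdS_left i (fun μ x => hG (hU μ x)) μ]
  have hE0 : ∑ ν : Fin (d + 1), trIP (fun _ => (1 : ℝ)) (cdS i U ν (GpY i (parSymY i) U v)) (cdS i U ν (GpY i (parSymY i) U v))
      ≤ trIP (fun _ => (1 : ℝ)) (GpY i (parSymY i) U v) v := by
    have h := sum_trIP_cdS_le_trIP_deltaPrimeAY i hG (parSymY i) U (parSymY_inv_symm U) (fun z w => parSymY_mem i hU z w) hU (GpY i (parSymY i) U v)
    rwa [hΔΦ] at h
  have hXQ : trIP (fun _ => (1 : ℝ)) (GpY i (parSymY i) U v) v ≤ trIP (fun _ => (1 : ℝ)) Λ Λ := by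
    set X := trIP (fun _ => (1 : ℝ)) (GpY i (parSymY i) U v) v with hX
    have hX0 : 0 ≤ X := le_trans (Finset.sum_nonneg fun _ _ => trIP_self_nonneg _ (fun _ => one_pos) _) hE0
    have hcs := trIP_sq_le (fun _ => (1 : ℝ)) (fun _ => one_pos) (cdS i U μ (GpY i (parSymY i) U v)) Λ
    have hμ : trIP (fun _ => (1 : ℝ)) (cdS i U μ (GpY i (parSymY i) U v)) (cdS i U μ (GpY i (parSymY i) U v)) ≤ X :=
      le_trans (Finset.single_le_sum (f := fun ν => trIP (fun _ => (1 : ℝ)) (cdS i U ν (GpY i (parSymY i) U v)) (cdS i U ν (GpY i (parSymY i) U v)))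
        (fun _ _ => trIP_self_nonneg _ (fun _ => one_pos) _) (Finset.mem_univ μ)) hE0
    have h3 : X ^ 2 ≤ X * trIP (fun _ => (1 : ℝ)) Λ Λ := by
      rw [hXeq]; rw [hXeq] at hμ
      exact hcs.trans (mul_le_mul_of_nonneg_right hμ hQ0)
    rcases hX0.eq_or_lt with h0 | hpos
    · rw [← h0]; exact hQ0
    · have h4 : X * X ≤ trIP (fun _ => (1 : ℝ)) Λ Λ * X := by nlinarith
      exact le_of_mul_le_mul_right h4 hpos
  -- the energy of the weighted field
  have hE : ∑ ν : Fin (d + 1), trIP (fun _ => (1 : ℝ)) (cdS i U ν (fun w => ((ω w : ℝ) : ℂ) • GpY i (parSymY i) U v w))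
        (cdS i U ν (fun w => ((ω w : ℝ) : ℂ) • GpY i (parSymY i) U v w))
      ≤ trIP (fun _ => (1 : ℝ)) (GpY i (parSymY i) U v) v + (((d : ℝ) + 1) * θb + θs / 2) *
          ∑ z : SiteY i, (((((ℓ + 1) ^ (blkOf i.D.toDomains z).1.1 : ℕ) : ℝ)) ^ 2)⁻¹ * ∑ a, ∑ b, ‖(((ω z : ℝ) : ℂ) • GpY i (parSymY i) U v z) a b‖ ^ 2 := by
    have h1 := sum_trIP_cdS_le_trIP_deltaPrimeAY i hG (parSymY i) U (parSymY_inv_symm U) (fun z w => parSymY_mem i hU z w) hU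
      (fun w => ((ω w : ℝ) : ℂ) • GpY i (parSymY i) U v w)
    have h2 := trIP_wsmul_deltaPrimeAY_winv_ge i hG (parSymY i) U (parSymY_inv_symm U) (fun z w => parSymY_mem i hU z w) hU hω hb1 hb2 hs
      (fun w => ((ω w : ℝ) : ℂ) • GpY i (parSymY i) U v w)
    rw [conj_wsmul_GpY_eq_pairing i hG hU hω hv hωB] at h2
    linarith
  have hsum := sum_wsq_hs_cdS_le i hG hU hω hθb0 hθb1 hb2 (GpY i (parSymY i) U v)
  -- restrict to `A`
  have hPA : W ^ 2 * ∑ z ∈ A, ∑ ν : Fin (d + 1), ∑ a, ∑ b, ‖cdS i U ν (GpY i (parSymY i) U v) z a b‖ ^ 2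
      ≤ ∑ z : SiteY i, ∑ ν : Fin (d + 1), ω z ^ 2 * ∑ a, ∑ b, ‖cdS i U ν (GpY i (parSymY i) U v) z a b‖ ^ 2 := by
    rw [Finset.mul_sum]
    have hterm : ∀ z, 0 ≤ ∑ ν : Fin (d + 1), ω z ^ 2 * ∑ a, ∑ b, ‖cdS i U ν (GpY i (parSymY i) U v) z a b‖ ^ 2 :=
      fun z => Finset.sum_nonneg fun _ _ => mul_nonneg (sq_nonneg _) (hs_nonneg _)
    refine le_trans (Finset.sum_le_sum fun z hz => ?_) (Finset.sum_le_univ_sum_of_nonneg hterm)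
    rw [Finset.mul_sum]
    exact Finset.sum_le_sum fun _ _ => mul_le_mul_of_nonneg_right (pow_le_pow_left₀ hW0.le (hW z hz) 2) (hs_nonneg _)
  exact graddiv_arith hE hsum hPA hκ hθ hiX hXQ hM0 hW0

/-- ★★★ **(3.46e) WITH THE CANONICAL AGMON WEIGHT** `e^{δ₀ρ}`, `δ₀ = 1∕(4(d+2))` (`ρ` bond-Lipschitz at scale `(L^{lev})⁻¹`, block oscillation `≤ d+1`, `ρ = 0` on
`B ⊇ supp ∇\*_{U,μ}λ`, `ρ ≥ r` on `A`): `Σ_{z∈A}Σ_ν HS((∇_{U,ν}G′(U)∇\*_{U,μ}λ)(z)) ≤ 10·‖λ‖²₁∕(e^{δ₀r})²`.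
[cite: Balaban1985BackgroundPropagators, Thm 3.1 (3.46) p.398; Agmon1982, Ch.1, Thm 1.5] -/
theorem hs_restrict_cdS_GpY_cdsS_le_exp_canonical [Nonempty (Fin N)] (hG : G ≤ B7Prop2Explicit.unitaryUnits (Matrix (Fin N) (Fin N) ℂ))
    {U : CfgY (Matrix (Fin N) (Fin N) ℂ) i} {c α₀ : ℝ} (hC0 : 0 ≤ c * (kGeo i).M * α₀) (hC1 : c * (kGeo i).M * α₀ * ((d : ℝ) + 1) ≤ 1 / 16)
    (hreg : (bg9K (Matrix (Fin N) (Fin N) ℂ) G i).Reg335 c α₀ U) {ρ : SiteY i → ℝ}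
    (hρ1 : ∀ μ z, |ρ (shiftY i μ z) - ρ z| ≤ ((((ℓ + 1) ^ (blkOf i.D.toDomains z).1.1 : ℕ) : ℝ))⁻¹)
    (hρ2 : ∀ μ z, |ρ (shiftY i μ z) - ρ z| ≤ ((((ℓ + 1) ^ (blkOf i.D.toDomains (shiftY i μ z)).1.1 : ℕ) : ℝ))⁻¹)
    (hρD : ∀ z w : SiteY i, blkOf i.D.toDomains w = blkOf i.D.toDomains z → |ρ z - ρ w| ≤ (d : ℝ) + 1) (μ : Fin (d + 1))
    {A B : Finset (SiteY i)} {Λ : SiteY i → Matrix (Fin N) (Fin N) ℂ} (hv : ∀ z, z ∉ B → cdsS i U μ Λ z = 0) (hρB : ∀ z ∈ B, ρ z = 0)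
    {r : ℝ} (hr : ∀ z ∈ A, r ≤ ρ z) :
    ∑ z ∈ A, ∑ ν : Fin (d + 1), ∑ a, ∑ b, ‖cdS i U ν (GpY i (parSymY i) U (cdsS i U μ Λ)) z a b‖ ^ 2
      ≤ 10 * trIP (fun _ => (1 : ℝ)) Λ Λ / Real.exp ((1 / (4 * ((d : ℝ) + 2))) * r) ^ 2 := by
  have hd0 : (0 : ℝ) ≤ d := Nat.cast_nonneg d
  have hd2 : (0 : ℝ) < 4 * ((d : ℝ) + 2) := by positivity
  have hδ0 : (0 : ℝ) ≤ 1 / (4 * ((d : ℝ) + 2)) := by positivity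
  have hδ1 : 1 / (4 * ((d : ℝ) + 2)) ≤ 1 := by rw [div_le_one hd2]; linarith
  have hδD : 1 / (4 * ((d : ℝ) + 2)) * ((d : ℝ) + 1) ≤ 1 := by
    rw [div_mul_eq_mul_div, one_mul, div_le_one hd2]; linarith
  have hδκ0 : (1 / (4 * ((d : ℝ) + 2))) ^ 2 * (2 * ((d : ℝ) + 1) + ((d : ℝ) + 1) ^ 2) ≤ 1 / 16 := by
    rw [div_pow, one_pow, mul_pow, one_div_mul_eq_div, div_le_iff₀ (by positivity)]
    nlinarith
  have hδκ : ((d : ℝ) + 1) * (2 * (1 / (4 * ((d : ℝ) + 2))) ^ 2) + (2 * (1 / (4 * ((d : ℝ) + 2))) ^ 2 * ((d : ℝ) + 1) ^ 2) / 2 ≤ 1 / 16 := by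
    have e : ((d : ℝ) + 1) * (2 * (1 / (4 * ((d : ℝ) + 2))) ^ 2) + (2 * (1 / (4 * ((d : ℝ) + 2))) ^ 2 * ((d : ℝ) + 1) ^ 2) / 2
        = (1 / (4 * ((d : ℝ) + 2))) ^ 2 * (2 * ((d : ℝ) + 1) + ((d : ℝ) + 1) ^ 2) := by ring
    rw [e]; exact hδκ0
  have hω : ∀ z, 0 < Real.exp (1 / (4 * ((d : ℝ) + 2)) * ρ z) := fun z => Real.exp_pos _
  have hωB : ∀ z ∈ B, Real.exp (1 / (4 * ((d : ℝ) + 2)) * ρ z) = 1 := fun z hz => by rw [hρB z hz, mul_zero, Real.exp_zero]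
  have hW : ∀ z ∈ A, Real.exp (1 / (4 * ((d : ℝ) + 2)) * r) ≤ Real.exp (1 / (4 * ((d : ℝ) + 2)) * ρ z) :=
    fun z hz => Real.exp_le_exp.2 (mul_le_mul_of_nonneg_left (hr z hz) hδ0)
  exact hs_restrict_cdS_GpY_cdsS_le i hG hC0 hC1 hreg hω (by positivity) (by positivity)
    (fun μ z => bondRatio_exp_le i hδ0 hδ1 μ z (hρ1 μ z)) (fun μ z => bondRatio_exp_le' i hδ0 hδ1 μ z (hρ2 μ z))
    (fun z w hzw => blockOsc_exp_le i hδ0 hδD z w (hρD z w hzw)) hδκ μ hv hωB (Real.exp_pos _) hW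

end Literature.MathematicalPhysics.QuantumFieldTheory.Balaban1983to89.B9Thm31SiteGradGpDivDecayReg335Y
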